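import Literature.AlgebraicGeometry.HodgeTheory.NodalPencilShellInvariance
import Literature.Geometry.Manifold.DiscFoldRotationIsotopyInvariant
import HarnessLib

/-!
# The fold isotopy of a monomial pencil near a node on `𝒴°(ℂ)`, preserving the slice and the shell radius levels

Family `hodge`, layer `Literature/AlgebraicGeometry/HodgeTheory`. Written by the prover seat `hodge-nonav-prover-Bx` (g15, cell
`hodge-nonav`) as a brick of the ODP-ISOTOPY port (memo `PROGRAMME-ODP-ISOTOPY-Bx-g13` §2; Picard–Lefschetz binder hPL₁
`picardLefschetz_oneNode` of crux K1-B, stmt-HodgeConjecture-19716): the generalisation of prover-Ax's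
`CyclicCoverPencilFoldIsotopyInvariant` (step A3a for the quaternary cyclic pencil `x₃^p = f₁ + c·x₂^p`) to an ARBITRARY degree `d ≥ 1`,
`n + 2` variables, chart `xᵢ ≠ 0` and the monomial pencil direction `xᵢ^d`: the instantiation of the abstract fold isotopy
`Geometry/Manifold/DiscFoldRotationIsotopyInvariant.exists_rotationIsotopy_of_folds_invariant` with the two complete cut-off flows
`θ₁, θ₂` (`NodalPencilCutoffFlows.exists_cutoff_globalFlow`) of the shell-tangent lifts (`NodalPencilShellFields.exists_shell_tangent_lift`)
of two coefficient fields `W₁, W₂` equal to `e_{xᵢ^d}` resp. `i·e_{xᵢ^d}` near the nodal coefficient vector `b₀`, the invariant set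
`A = S ∩ {s₁² < F}` and the pencil coordinate `c = b_{xᵢ^d} − (b₀)_{xᵢ^d}` (`NodalPencilSaturatedRadius`), and the fold hypotheses
(`NodalPencilShellInvariance.fold_hypothesis_of_flow`).

* `exists_pencil_foldIsotopy_invariant` — **a continuous `g : ℝ × 𝒴°(ℂ) → 𝒴°(ℂ)`, `g₀ = id = g_{2π}`, which on `A ∩ {|c| < ρW}` preserves
  `A`, rotates the pencil coordinate (`c(g(θ, q)) = e^{iθ} c(q)`) and satisfies the group law, preserves the slice `S = {b' = b'₀}`, and
  preserves the saturated radius `F` at points of `S` with `s₀² < F < r₂²`.**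

Everything is proved; no definitions, no named facts (radii, bumps, Lipschitz bounds are explicit hypotheses, discharged by the final
choice of constants). Honest scope: plumbing of the classical construction of the geometric monodromy of a pencil near an ordinary
double point; nothing here says HC or any rung is proved.

## References

* [ArnoldGuseinzadeVarchenko2012] V. I. Arnold, S. M. Gusein-Zade, A. N. Varchenko, Singularities of Differentiable Maps II (2012),
  Part I §1.1, §2.1.
* [BrockerJanichIDT1982] T. Bröcker, K. Jänich, Introduction to Differential Topology (1982), (8.12).
-/

noncomputable section

open CategoryTheory AlgebraicGeometry MvPolynomial TopologicalSpace Set Topology Filter Complex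
open scoped Manifold ContDiff Real
open Literature.AlgebraicGeometry.Motives Literature.AlgebraicGeometry.Motives.UniversalHypersurface
open Literature.AlgebraicGeometry.HodgeTheory.UniversalHypersurface Literature.Geometry.ComplexAnalytic Literature.Geometry.Manifold

namespace Literature.AlgebraicGeometry.HodgeTheory

namespace NodalPencil

/-- **The fold isotopy of a monomial pencil near a node.** Data: `d ≥ 1`, a chart index `i`, the nodal coefficient vector `b₀`, a `C^∞`
Morse chart `Θ` (with `C^∞` inverse) in which the solved coefficient of `xᵢ^d` at the remaining coefficients `b'₀` is
`(b₀)_{xᵢ^d} + Σⱼ (Θ y)ⱼ²`, `φ` that solved coefficient minus `(b₀)_{xᵢ^d}` (continuous), radii `0 < s₀`, `s₀² < s₁² < r₂² < R''' < R''`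
with `{Σ|z|² ≤ R''} ⊆ Θ.target`, `δ < s₀²`, a node bump `β` (`C^∞`, zero for `‖y‖ > Rβ`, `1` on `‖y − y₀‖ < η`, supported in the Morse
ball of radius `s₀`), a coefficient bump `χ'` (`C^∞`, zero off a compact `K ⊆ V` with all fibre-singular points over `V` in `N_η(y₀)`,
supported in `‖b − b₀‖ < ρK ≤ δ`, `1` on `‖b − b₀‖ < ρW`), and `C^∞` coefficient fields `W₁, W₂` along `e_{xᵢ^d}` equal to `1`, `i` there,
with Lipschitz one-dimensional reductions. [cite: ArnoldGuseinzadeVarchenko2012, Part I §2.1] [cite: BrockerJanichIDT1982, (8.12)] -/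
theorem exists_pencil_foldIsotopy_invariant {n d : ℕ} {i : Fin (n + 2)} (hd : 0 < d) (b₀ : DegIndex n d → ℂ)
    {Θ : OpenPartialHomeomorph (Fin (n + 1) → ℂ) (Fin (n + 1) → ℂ)}
    (hΘ : ContDiffOn ℝ ∞ Θ Θ.source) (hΘs : ContDiffOn ℝ ∞ Θ.symm Θ.target)
    (hΘc : ∀ y ∈ Θ.source, regChartCoeffVec n d i
      (Sum.elim (fun m : {m : DegIndex n d // m ≠ regPowIndex n d i} => b₀ m.1) y) (regPowIndex n d i) =
        b₀ (regPowIndex n d i) + ∑ j, (Θ y j) ^ 2)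
    (φ : (Fin (n + 1) → ℂ) → ℂ) (hφc : Continuous φ)
    (hφ : ∀ y, φ y = regChartCoeffVec n d i
      (Sum.elim (fun m : {m : DegIndex n d // m ≠ regPowIndex n d i} => b₀ m.1) y) (regPowIndex n d i) - b₀ (regPowIndex n d i))
    {s₀ s₁ r₂ δ R''' R'' : ℝ} (hs₀ : 0 < s₀) (hs₀₁ : s₀ ^ 2 < s₁ ^ 2) (hs₁r : s₁ ^ 2 < r₂ ^ 2) (hr : r₂ ^ 2 < R''') (hR : R''' < R'')
    (hR'' : {z : Fin (n + 1) → ℂ | ∑ j, ‖z j‖ ^ 2 ≤ R''} ⊆ Θ.target) (hδ : δ < s₀ ^ 2)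
    (y₀ : Fin (n + 1) → ℂ) {η : ℝ} (β : (Fin (n + 1) → ℂ) → ℝ) (hβ : ContDiff ℝ ∞ β) {Rβ : ℝ} (hβR : ∀ y, Rβ < ‖y‖ → β y = 0)
    (hβ1 : ∀ y, ‖y - y₀‖ < η → β y = 1) (hβs : ∀ y, β y ≠ 0 → y ∈ Θ.source ∧ ∑ j, ‖Θ y j‖ ^ 2 < s₀ ^ 2)
    (χ' : (DegIndex n d → ℂ) → ℝ) (hχ : ContDiff ℝ ∞ χ')
    {K V : Set (DegIndex n d → ℂ)} (hK : IsCompact K) (hKV : K ⊆ V) (hχK0 : ∀ b, b ∉ K → χ' b = 0)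
    (hV : ∀ P : ComplexPoints (totalSpaceOver ℂ n d),
      P ∉ Set.range (AlgPoints.map (regularToTotalSpaceOver ℂ n d) : ComplexPoints (regularTotal ℂ n d) → _) →
        tCoeff ℂ n d P ∈ V → P ∈ nodeNbhd n d i y₀ η)
    {ρK ρW : ℝ} (hχK : ∀ b, χ' b ≠ 0 → ‖b - b₀‖ < ρK) (hρδ : ρK ≤ δ) (hχ1 : ∀ b, ‖b - b₀‖ < ρW → χ' b = 1)
    (W₁ W₂ : (DegIndex n d → ℂ) → (DegIndex n d → ℂ)) (hW₁ : ContDiff ℝ ∞ W₁) (hW₂ : ContDiff ℝ ∞ W₂)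
    (hW₁' : ∀ b (m : DegIndex n d), m ≠ regPowIndex n d i → W₁ b m = 0)
    (hW₂' : ∀ b (m : DegIndex n d), m ≠ regPowIndex n d i → W₂ b m = 0)
    (hW₁u : ∀ b, ‖b - b₀‖ < ρW → W₁ b (regPowIndex n d i) = 1)
    (hW₂u : ∀ b, ‖b - b₀‖ < ρW → W₂ b (regPowIndex n d i) = I)
    {K₁ K₂ : NNReal}
    (hv₁ : LipschitzWith K₁ (fun z : ℂ => (χ' (b₀ + Pi.single (regPowIndex n d i) z) : ℂ) *
      W₁ (b₀ + Pi.single (regPowIndex n d i) z) (regPowIndex n d i)))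
    (hv₂ : LipschitzWith K₂ (fun z : ℂ => (χ' (b₀ + Pi.single (regPowIndex n d i) z) : ℂ) *
      W₂ (b₀ + Pi.single (regPowIndex n d i) z) (regPowIndex n d i))) :
    ∃ g : ℝ × ComplexPoints (regularTotal ℂ n d) → ComplexPoints (regularTotal ℂ n d),
      Continuous g ∧ (∀ q, g (0, q) = q) ∧ (∀ q, g (2 * π, q) = q) ∧
      (∀ θ, ∀ q ∈ invariantSet n d i Θ R''' R'' b₀ s₁, ‖pencilCoord n d i b₀ q‖ < ρW →
        g (θ, q) ∈ invariantSet n d i Θ R''' R'' b₀ s₁ ∧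
          pencilCoord n d i b₀ (g (θ, q)) = Complex.exp (θ * I) * pencilCoord n d i b₀ q) ∧
      (∀ θ θ', ∀ q ∈ invariantSet n d i Θ R''' R'' b₀ s₁, ‖pencilCoord n d i b₀ q‖ < ρW → g (θ + θ', q) = g (θ, g (θ', q))) ∧
      (∀ θ q, q ∈ pencilSlice n d i b₀ → g (θ, q) ∈ pencilSlice n d i b₀) ∧
      (∀ θ q, q ∈ pencilSlice n d i b₀ → s₀ ^ 2 < satRadius n d i Θ R''' R'' q → satRadius n d i Θ R''' R'' q < r₂ ^ 2 →
        satRadius n d i Θ R''' R'' (g (θ, q)) = satRadius n d i Θ R''' R'' q) := by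
  haveI := locallyOfFiniteType_regularTotal_hom ℂ n d hd
  haveI := smoothOfRelativeDimension_regularTotal_hom ℂ n d hd
  letI := ComplexPoints.chartedSpace (regularTotal ℂ n d) (n + Fintype.card (DegIndex n d))
  haveI := ComplexPoints.isManifold_real (regularTotal ℂ n d) (n + Fintype.card (DegIndex n d))
  -- the shell-tangent lifts
  obtain ⟨X₁, hX₁, hXW₁, hXK₁⟩ := exists_shell_tangent_lift Θ φ s₀ r₂ δ d i
    (fun m : {m : DegIndex n d // m ≠ regPowIndex n d i} => b₀ m.1) hd hφc hΘ hΘs (b₀ (regPowIndex n d i)) hΘc hφ hs₀ hr hR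
    hR'' hδ hW₁
  obtain ⟨X₂, hX₂, hXW₂, hXK₂⟩ := exists_shell_tangent_lift Θ φ s₀ r₂ δ d i
    (fun m : {m : DegIndex n d // m ≠ regPowIndex n d i} => b₀ m.1) hd hφc hΘ hΘs (b₀ (regPowIndex n d i)) hΘc hφ hs₀ hr hR
    hR'' hδ hW₂
  -- their cut-off flows
  obtain ⟨θ₁, hθ₁, h0₁, hadd₁, hint₁, -⟩ :=
    exists_cutoff_globalFlow n d i y₀ η β χ' hd hβ hβR hβ1 hχ hK hKV hχK0 hV X₁ hX₁
  obtain ⟨θ₂, hθ₂, h0₂, hadd₂, hint₂, -⟩ :=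
    exists_cutoff_globalFlow n d i y₀ η β χ' hd hβ hβR hβ1 hχ hK hKV hχK0 hV X₂ hX₂
  have hpc : Continuous (pencilCoord n d i b₀) := continuous_pencilCoord n d i b₀ hd
  -- the fold hypotheses
  have h₁ : ∀ x ∈ invariantSet n d i Θ R''' R'' b₀ s₁, ∀ t : ℝ, (∀ s ∈ uIcc 0 t, ‖pencilCoord n d i b₀ x + s‖ < ρW) →
      ∀ s ∈ uIcc 0 t, θ₁ (s, x) ∈ invariantSet n d i Θ R''' R'' b₀ s₁ ∧
        pencilCoord n d i b₀ (θ₁ (s, x)) = pencilCoord n d i b₀ x + s := by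
    intro x hx t hseg s hs
    have hseg' : ∀ s ∈ uIcc 0 t, ‖pencilCoord n d i b₀ x + s • (1 : ℂ)‖ < ρW := fun s hs => by
      rw [Complex.real_smul, mul_one]; exact hseg s hs
    have h := fold_hypothesis_of_flow hd β χ' X₁ hXW₁ hW₁' h0₁ hint₁ hR hr φ hφ hχK hρδ hXK₁ hΘ hR'' hs₀₁ hs₁r hβs hχ1 hW₁u
      hv₁ hx hseg' hs
    rw [Complex.real_smul, mul_one] at h
    exact h
  have h₂ : ∀ x ∈ invariantSet n d i Θ R''' R'' b₀ s₁, ∀ t : ℝ, (∀ s ∈ uIcc 0 t, ‖pencilCoord n d i b₀ x + s * I‖ < ρW) →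
      ∀ s ∈ uIcc 0 t, θ₂ (s, x) ∈ invariantSet n d i Θ R''' R'' b₀ s₁ ∧
        pencilCoord n d i b₀ (θ₂ (s, x)) = pencilCoord n d i b₀ x + s * I := by
    intro x hx t hseg s hs
    have hseg' : ∀ s ∈ uIcc 0 t, ‖pencilCoord n d i b₀ x + s • I‖ < ρW := fun s hs => by
      rw [Complex.real_smul]; exact hseg s hs
    have h := fold_hypothesis_of_flow hd β χ' X₂ hXW₂ hW₂' h0₂ hint₂ hR hr φ hφ hχK hρδ hXK₂ hΘ hR'' hs₀₁ hs₁r hβs hχ1 hW₂u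
      hv₂ hx hseg' hs
    rw [Complex.real_smul] at h
    exact h
  obtain ⟨g, hg, hg0, hg2π, hgA, hgadd, hgB⟩ :=
    exists_rotationIsotopy_of_folds_invariant hpc hθ₁.continuous h0₁ hadd₁ hθ₂.continuous h0₂ hadd₂ h₁ h₂
  -- the flows preserve the slice (all orbits) and `F` on the slab (orbits in the slice)
  have hb' : ∀ (θ' : ℝ × ComplexPoints (regularTotal ℂ n d) → ComplexPoints (regularTotal ℂ n d))
      (X' : Π Q : ComplexPoints (regularTotal ℂ n d), TangentSpace (𝓡 (2 * (n + Fintype.card (DegIndex n d)))) Q)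
      {W : (DegIndex n d → ℂ) → (DegIndex n d → ℂ)},
      (∀ Q, mfderiv (𝓡 (2 * (n + Fintype.card (DegIndex n d)))) 𝓘(ℝ, DegIndex n d → ℂ) (fun Q' => regCoeff ℂ n d Q') Q (X' Q) =
        W (regCoeff ℂ n d Q)) → (∀ b (m : DegIndex n d), m ≠ regPowIndex n d i → W b m = 0) →
      (∀ Q, IsMIntegralCurve (fun s => θ' (s, Q)) (fun Q' => cutoffScalar n d i β χ' Q' • X' Q')) → (∀ Q, θ' (0, Q) = Q) →
      ∀ s x, x ∈ pencilSlice n d i b₀ → θ' (s, x) ∈ pencilSlice n d i b₀ := by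
    intro θ' X' W hXW' hW'' hint h0' s x hx m
    rw [← hx m]
    have h := regCoeff_apply_integralCurve_const n d hd X' (cutoffScalar n d i β χ') hXW' (fun b => hW'' b m.1 m.2) (hint x) 0 s
    simpa [h0' x] using h
  have hF : ∀ (θ' : ℝ × ComplexPoints (regularTotal ℂ n d) → ComplexPoints (regularTotal ℂ n d))
      (X' : Π Q : ComplexPoints (regularTotal ℂ n d), TangentSpace (𝓡 (2 * (n + Fintype.card (DegIndex n d)))) Q)
      {W : (DegIndex n d → ℂ) → (DegIndex n d → ℂ)}
      (_ : ∀ Q, mfderiv (𝓡 (2 * (n + Fintype.card (DegIndex n d)))) 𝓘(ℝ, DegIndex n d → ℂ) (fun Q' => regCoeff ℂ n d Q') Q (X' Q) =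
        W (regCoeff ℂ n d Q)) (_ : ∀ b (m : DegIndex n d), m ≠ regPowIndex n d i → W b m = 0)
      (_ : ∀ Q ∈ shellSet Θ φ s₀ r₂ δ d i (fun m : {m : DegIndex n d // m ≠ regPowIndex n d i} => b₀ m.1),
        mfderiv (𝓡 (2 * (n + Fintype.card (DegIndex n d)))) 𝓘(ℝ, ℝ)
          (regChartExtend n d i (fun v => ChartRadius.cutoff Θ R''' R'' (fun j => v (Sum.inr j)))) Q (X' Q) = 0)
      (_ : ∀ Q, IsMIntegralCurve (fun s => θ' (s, Q)) (fun Q' => cutoffScalar n d i β χ' Q' • X' Q')) (_ : ∀ Q, θ' (0, Q) = Q),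
      ∀ s x, x ∈ pencilSlice n d i b₀ →
        s₀ ^ 2 < satRadius n d i Θ R''' R'' x → satRadius n d i Θ R''' R'' x < r₂ ^ 2 →
          satRadius n d i Θ R''' R'' (θ' (s, x)) = satRadius n d i Θ R''' R'' x := by
    intro θ' X' W hXW' hW'' hXK' hint h0' s x hx hlo hhi
    have h0x : (fun s => θ' (s, x)) 0 ∈ invariantSet n d i Θ R''' R'' b₀ s₀ := by
      refine ⟨fun m => ?_, ?_⟩
      · simp only [h0' x]; exact hx m
      · simp only [h0' x]; exact hlo
    have hFs : ContMDiff (𝓡 (2 * (n + Fintype.card (DegIndex n d)))) 𝓘(ℝ, ℝ) 1 (satRadius n d i Θ R''' R'') :=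
      (contMDiff_satRadius n d i Θ R''' R'' hd hΘ hR hR'').of_le (by simp)
    have h := apply_integralCurve_const_of_slab_on (I := 𝓡 (2 * (n + Fintype.card (DegIndex n d)))) hFs isOpen_univ
      Set.ordConnected_univ ((hint x).isMIntegralCurveOn _)
      (fun r _ hlo' hhi' =>
        mfderiv_satRadius_orbit_eq_zero hd β χ' X' hXW' hW'' (hint x) h0x hR hr φ hφ hχK hρδ hXK' r hlo' hhi')
      (Set.mem_univ 0) (by simpa [h0' x] using hlo) (by simpa [h0' x] using hhi) (Set.mem_univ s)
    simpa [h0' x] using h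
  refine ⟨g, hg, hg0, hg2π, hgA, hgadd, fun θ q hq => ?_, fun θ q hq hlo hhi => ?_⟩
  · exact hgB (pencilSlice n d i b₀)
      (fun s x hx => hb' θ₁ X₁ hXW₁ hW₁' hint₁ h0₁ s x hx) (fun s x hx => hb' θ₂ X₂ hXW₂ hW₂' hint₂ h0₂ s x hx) θ q hq
  · have hB := hgB {Q | Q ∈ pencilSlice n d i b₀ ∧ satRadius n d i Θ R''' R'' Q = satRadius n d i Θ R''' R'' q}
      (fun s x hx => ⟨hb' θ₁ X₁ hXW₁ hW₁' hint₁ h0₁ s x hx.1, by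
        rw [← hx.2]
        exact hF θ₁ X₁ hXW₁ hW₁' hXK₁ hint₁ h0₁ s x hx.1 (hx.2 ▸ hlo) (hx.2 ▸ hhi)⟩)
      (fun s x hx => ⟨hb' θ₂ X₂ hXW₂ hW₂' hint₂ h0₂ s x hx.1, by
        rw [← hx.2]
        exact hF θ₂ X₂ hXW₂ hW₂' hXK₂ hint₂ h0₂ s x hx.1 (hx.2 ▸ hlo) (hx.2 ▸ hhi)⟩)
      θ q ⟨hq, rfl⟩
    exact hB.2

end NodalPencil

end Literature.AlgebraicGeometry.HodgeTheory

end
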